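/- LEAD seat `ym-line-cbag-p1` (prover-ym-line-cbag-p1-g28-0), LINE 7 `GlueballBandRecursion`, item ⟨stmt-QuantumFields-22957⟩
`OneParticleBlochSymbolFamily` (= `Band.EffectiveBlochSymbolFamily`): the THREE STUB STATEMENTS of the LEAD's one-XL-stub skeleton proposal
(planner STUB-PLAN S1–S4, 2026-08-28T18:17Z, re-cut after the S2 prefab landed): `IsolatedBandFrame` (S1 ∪ S4b: the cluster expansion's
output, XL), `SymbolRegularityShell` (S3, pure real analysis), `UpperGapPropagation` (S4a, pure spectral bookkeeping).  Definitions only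
(route-posited objects, reviewed); the composition `IsolatedBandFrame → SymbolRegularityShell → UpperGapPropagation → EffectiveBlochSymbolFamily`
is proved in `…FamilyOfIsolatedBand.lean`.  Route-independent. -/
import Summits.QuantumFields.YangMills.Theorems.GlueballBandRecursionTransferSymbol
import Summits.QuantumFields.YangMills.Theorems.GlueballBandRecursionEffectiveBlochSymbolDefs

/-!
# Route `GlueballBandRecursion`, item `OneParticleBlochSymbolFamily` (stmt-QuantumFields-22957): the isolated-band-frame stub and the two
# pure shells through which it implies the effective Bloch symbol family

What a finite-torus one-particle cluster expansion of the strong-coupling transfer matrix `𝕋 = wilsonTorusTransferMatrix r.ρ β N` has to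
DELIVER, per compact `G` and faithful `r`, with constants uniform on the window `0 ≤ β ≤ strongCouplingRadius r.ρ` and in `N ≥ L₀`, for the
item `Band.EffectiveBlochSymbolFamily` to follow by ALREADY-LANDED linear algebra (`…BlochTransfer`, `…TransferSymbol`) plus two pure lemmas:

* `IsolatedBandFrame` (stub S1 ∪ S4b, XL — the ONE load-bearing statement): per `β` either the rank-one escape, or a log-rate `ℓ` and per
  `N ≥ L₀` a translation-COVARIANT orthonormal frame `ψ : (ℤ/N)³ × Fin n → L²` (`n ≤ n₀` species) spanning a `𝕋`-invariant subspace, an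
  orthonormal eigenbasis `e`, `μ` of that span with `q_min λ₊ ≤ μ_k < λ₊` (the ONE-GLUEBALL BAND), ISOLATION (every eigenvector orthogonal to
  the band is the ground state direction or has eigenvalue `≤ δ q_min λ₊`, `δ < 1` uniform), ℓ¹-moment bounds on the normalised hopping kernel
  `J = transferKernel r β N ψ` relative to its on-site scale `s` (diagonal dominance `θ < 1`, moments `M`, uniform), volume stability of the band
  top `|log(μ_max/λ₊) − ℓ| ≤ D'/N`, and a DILUTE ANCHOR: one Euclidean time `s₀ + 2 ≤ N/4` at which `x_{s₀+2} ≤ 2·Σ_k (μ_k/λ₊)^{s₀+2}`.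
* `SymbolRegularityShell` (stub S3, L, pure real analysis — the twin of the width seat w5's `…SymbolRegularity`): a reflection-symmetric real
  torus kernel with on-site floor `s`, off-site ℓ¹ mass `≤ θ s`, on-site ℓ¹ mass `≤ M s` and second centred moment `≤ M s` has a symmetrised symbol
  `kernelSymbol J` (`…TransferSymbol`) with POSITIVE Rayleigh quotients and the log-C² second-difference bound of the def with a constant
  `K = K(θ, M)` depending on `θ < 1` and `M` only.
* `UpperGapPropagation` (stub S4a, M, pure spectral bookkeeping — the twin of the width seat w3's `…BandUpperGap`): for an isolated band as
  above, the non-band part of the thermal trace contracts: `x_{t+2} − Σ_k(μ_k/λ₊)^{t+2} ≤ (δ q_min)^{t−s}·(x_{s+2} − Σ_k(μ_k/λ₊)^{s+2})`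
  for `s ≤ t` (`x = traceExcess`).
Small auxiliary objects: `entryNorm A = Σ_{ij} |A_{ij}|`, `siteSize z = Σ_μ |z̃_μ|` (`z̃ = valMinAbs`).

Why cut this way: the two shells are TRUE pure-mathematics statements provable now (their twins are being landed by the width seats; adapters
discharge these stubs), so the skeleton has exactly one open stub, `IsolatedBandFrame` — the periodic-torus, `N`-uniform version of Schor's
one-glueball band (Commun. Math. Phys. 92 (1984) 369, infinite volume only) — which is what a crew (or the disprover) should attack.
Why it might fail (recorded for the disprover): isolation with a UNIFORM `δ < 1` requires every non-band excitation (two-glueball states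
`≈ q²`, higher-representation plaquette species, torelons `≈ e^{−σN}`, needing `L₀ ≳ 5`) to sit below `δ·q_min` for ALL `β` on the window;
the dilute anchor must exist at a time `≤ N/4` uniformly in `N` (true heuristically for `s₀ + 2 ≍ log N / log(1/q)`).

HONEST FRAMING.  Definitions; nothing is proved here — not the item, not the rung `ColdDoublingRecursionStrongCoupling` (RECORD-type, strong
coupling), and a fortiori not the Yang–Mills mass gap / the summit `YangMills`.
-/

set_option autoImplicit false

noncomputable section

open scoped InnerProductSpace BigOperators Matrix
open Finset MeasureTheory
open Literature.MathematicalPhysics.QuantumFieldTheory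
open Literature.MathematicalPhysics.QuantumFieldTheory.Balaban1983to89.Missing (strongCouplingRadius)

namespace Summit.QuantumFields.YangMills.Theorems.GlueballBandRecursion.Band

/-- The ℓ¹ entry norm `Σ_{ij} |A_{ij}|` of a real square matrix (dominates every Rayleigh quotient: `|⟪u, A v⟫| ≤ entryNorm A·‖u‖·‖v‖`). -/
def entryNorm {n : ℕ} (A : Matrix (Fin n) (Fin n) ℝ) : ℝ := ∑ i, ∑ j, |A i j|

/-- The ℓ¹ size `Σ_μ |z̃_μ|` of the centred representative `z̃ = valMinAbs` of a torus site `z ∈ (ℤ/N)³`. -/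
def siteSize {N : ℕ} (z : Site 3 N) : ℕ := ∑ μ : Fin 3, ((z μ).valMinAbs).natAbs

/-- **Stub S3 (pure real analysis): regularity of the symbol of a diagonally dominant kernel with two moments.**  For every dominance ratio
`θ < 1` and relative mass/moment bound `M` there is `K ≥ 0` such that for every torus `(ℤ/N)³`, every `n`, every reflection-symmetric
real kernel `J` (`J(−z) = J(z)ᵀ`) and scale `s > 0` with on-site floor `Re⟪u, J(0)u⟫ ≥ s‖u‖²`, off-site mass `Σ_{z ≠ 0} ‖J(z)‖₁ ≤ θ s`,
on-site mass `‖J(0)‖₁ ≤ M s` and centred second moment `Σ_z |z̃|₁² ‖J(z)‖₁ ≤ M s` (`‖·‖₁ = entryNorm`), the symmetrised symbol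
`B̃_J = kernelSymbol J` has, for every unit `u`: positive Rayleigh quotients `R_u(q) = Re⟪u, B̃_J(q)u⟫ > 0` and
`2 log R_u(x) − K|v|² ≤ log R_u(x+v) + log R_u(x−v)` for all `x, v ∈ ℝ³` (the clauses (P1), (P2) of `EffectiveBlochSymbolFamily`).
[`R_u ≥ (1−θ)s =: r₀`; with the majorants `a_z = ‖J(z)‖₁` the width seat w5's `Symbol.symbol_logC2` gives
`K = M₂/r₀ + M₀M₂/r₀² ≤ M/(1−θ) + (M+θ)M/(1−θ)²`.] -/
def SymbolRegularityShell : Prop :=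
  ∀ (θ M : ℝ), 0 ≤ θ → θ < 1 → 0 ≤ M → ∃ K : ℝ, 0 ≤ K ∧
    ∀ (N : ℕ) [NeZero N] (n : ℕ) (J : Site 3 N → Matrix (Fin n) (Fin n) ℝ) (s : ℝ), 0 < s →
      (∀ z, J (-z) = (J z)ᵀ) →
      (∀ u : EuclideanSpace ℂ (Fin n),
        s * ‖u‖ ^ 2 ≤ RCLike.re ⟪u, Matrix.toEuclideanLin ((J 0).map Complex.ofReal) u⟫_ℂ) →
      (∑ z ∈ Finset.univ.erase 0, entryNorm (J z) ≤ θ * s) →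
      (entryNorm (J 0) ≤ M * s) →
      (∑ z, (siteSize z : ℝ) ^ 2 * entryNorm (J z) ≤ M * s) →
      ∀ u : EuclideanSpace ℂ (Fin n), ‖u‖ = 1 →
        (∀ q, 0 < RCLike.re ⟪u, Matrix.toEuclideanLin (kernelSymbol J q) u⟫_ℂ) ∧
        ∀ x v : Fin 3 → ℝ,
          2 * Real.log (RCLike.re ⟪u, Matrix.toEuclideanLin (kernelSymbol J x) u⟫_ℂ) - K * ∑ i, v i ^ 2 ≤
            Real.log (RCLike.re ⟪u, Matrix.toEuclideanLin (kernelSymbol J (x + v)) u⟫_ℂ) +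
              Real.log (RCLike.re ⟪u, Matrix.toEuclideanLin (kernelSymbol J (x - v)) u⟫_ℂ)

/-- **Stub S4a (pure spectral bookkeeping): the non-band part of the thermal trace contracts under band isolation.**  On the window, for a
finite orthonormal family `e` of eigenvectors of `𝕋 = wilsonTorusTransferMatrix r.ρ β N` (the band) with `q_min λ₊ ≤ μ_k < λ₊`
(`λ₊ = transferSpectralRadius`) that is ISOLATED — every eigenvector of `𝕋` orthogonal to all `e_k` is zero, or has the top eigenvalue `λ₊`,
or has eigenvalue `≤ δ·q_min·λ₊` (`0 ≤ δ < 1`) — the remainder `R_t = x_t − Σ_k (μ_k/λ₊)^t` of the thermal trace `x_t = traceExcess r.ρ β N t`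
satisfies `R_{t+2} ≤ (δ q_min)^{t−s} R_{s+2}` for all `s ≤ t`.  [In an eigenbasis `b_i` of `𝕋` every `b_i`, `i ≠ i₀`, lies in the band span
or is orthogonal to it with ratio `≤ δ q_min` (the top is simple on the window, `q_N ≤ e^{−1/2}`); Parseval.] -/
def UpperGapPropagation : Prop :=
  ∀ (G : Type) [Group G] [TopologicalSpace G] [IsTopologicalGroup G] [CompactSpace G],
    letI : MeasurableSpace G := borel G
    haveI : BorelSpace G := ⟨rfl⟩
    ∀ (r : LatticeRep G) (β : ℝ), 0 ≤ β → β ≤ strongCouplingRadius r.ρ →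
      ∀ (N : ℕ) [NeZero N] (n : ℕ)
        (e : Site 3 N × Fin n → Lp ℝ 2 (Measure.pi fun _ : Edge 3 N => haarProbability G))
        (μ : Site 3 N × Fin n → ℝ) (qmin δ : ℝ),
        Orthonormal ℝ e → (∀ k, wilsonTorusTransferMatrix r.ρ β N (e k) = μ k • e k) →
        0 < qmin → 0 ≤ δ → δ < 1 →
        (∀ k, qmin * transferSpectralRadius r.ρ β N ≤ μ k) → (∀ k, μ k < transferSpectralRadius r.ρ β N) →
        (∀ (v : Lp ℝ 2 (Measure.pi fun _ : Edge 3 N => haarProbability G)) (l : ℝ),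
          wilsonTorusTransferMatrix r.ρ β N v = l • v → (∀ k, ⟪e k, v⟫_ℝ = 0) →
            v = 0 ∨ l = transferSpectralRadius r.ρ β N ∨ l ≤ δ * qmin * transferSpectralRadius r.ρ β N) →
        ∀ s t : ℕ, s ≤ t →
          traceExcess r.ρ β N (t + 2) - ∑ k, (μ k / transferSpectralRadius r.ρ β N) ^ (t + 2) ≤
            (δ * qmin) ^ (t - s) *
              (traceExcess r.ρ β N (s + 2) - ∑ k, (μ k / transferSpectralRadius r.ρ β N) ^ (s + 2))

/-- **Stub S1 ∪ S4b (XL — the cluster expansion): the isolated one-glueball band frame of the strong-coupling torus transfer matrix.**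
Per compact `G` and faithful unitary `r`: uniform constants `n₀` (species), `θ < 1` (diagonal dominance of the hopping kernel), `M`
(relative on-site mass and second centred ℓ¹-moment of the hopping kernel), `δ < 1` (isolation ratio), `D'` (volume stability of the band top), `L₀`; for every
`β` on the window EITHER the rank-one escape (`q_N = 0` for all `N ≥ L₀`) OR a log-rate `ℓ` and, for every `N ≥ L₀`: a number of species
`0 < n ≤ n₀`, a translation-COVARIANT orthonormal frame `ψ` (`ψ_{(v+x,j)} = U_v ψ_{(x,j)}`, `U_v = koopmanTranslate`) spanning a
`𝕋`-invariant subspace, an orthonormal eigenbasis `e`, `μ` of the same span (`e_k ∈ span ψ`, `ψ_a ∈ span e`) — the BAND — with floor and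
ceiling `q_min λ₊ ≤ μ_k < λ₊`, ISOLATION as in `UpperGapPropagation`, the kernel bounds of `SymbolRegularityShell` for
`J = transferKernel r β N ψ` at some scale `s > 0`, a band-top index `k*` with `|log(μ_{k*}/λ₊) − ℓ| ≤ D'/N`, and a DILUTE ANCHOR `s₀` with
`s₀ + 2 ≤ N/4` whenever `8 ≤ N` and `x_{s₀+2} ≤ 2·Σ_k (μ_k/λ₊)^{s₀+2}`.
Sources for the expected proof: R. Schor, Nucl. Phys. B 222 (1983) 71 and Commun. Math. Phys. 92 (1984) 369 (one-glueball band, infinite volume);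
Borgs–Imbrie, Commun. Math. Phys. 145 (1992) (finite-size effective matrices); none does the periodic torus uniformly in `N`. -/
def IsolatedBandFrame : Prop :=
  ∀ (G : Type) [Group G] [TopologicalSpace G] [IsTopologicalGroup G] [CompactSpace G],
    letI : MeasurableSpace G := borel G
    haveI : BorelSpace G := ⟨rfl⟩
    ∀ r : LatticeRep G, ∃ (n₀ : ℕ) (θ M δ D' : ℝ), 0 ≤ θ ∧ θ < 1 ∧ 0 ≤ M ∧ 0 ≤ δ ∧ δ < 1 ∧ 0 ≤ D' ∧ ∃ L₀ : ℕ,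
      ∀ β : ℝ, 0 ≤ β → β ≤ strongCouplingRadius r.ρ →
        (∀ (N : ℕ) [NeZero N], L₀ ≤ N →
          (⨅ k : ℕ, traceExcess r.ρ β N (k + 2) ^ ((1 : ℝ) / ((k : ℝ) + 2))) = 0) ∨
        ∃ ℓ : ℝ, ∀ (N : ℕ) [NeZero N], L₀ ≤ N →
          ∃ (n : ℕ) (_ : 0 < n) (_ : n ≤ n₀)
            (ψ : Site 3 N × Fin n → Lp ℝ 2 (Measure.pi fun _ : Edge 3 N => haarProbability G))
            (e : Site 3 N × Fin n → Lp ℝ 2 (Measure.pi fun _ : Edge 3 N => haarProbability G))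
            (μ : Site 3 N × Fin n → ℝ) (qmin s : ℝ),
            -- the covariant frame and the band eigenbasis of its span
            Orthonormal ℝ ψ ∧
            (∀ (v x : Site 3 N) (j : Fin n), ψ (v + x, j) = koopmanTranslate N v (ψ (x, j))) ∧
            (∀ b, wilsonTorusTransferMatrix r.ρ β N (ψ b) ∈ Submodule.span ℝ (Set.range ψ)) ∧
            Orthonormal ℝ e ∧ (∀ k, wilsonTorusTransferMatrix r.ρ β N (e k) = μ k • e k) ∧
            (∀ k, e k ∈ Submodule.span ℝ (Set.range ψ)) ∧ (∀ a, ψ a ∈ Submodule.span ℝ (Set.range e)) ∧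
            -- band floor / ceiling and isolation
            0 < qmin ∧ (∀ k, qmin * transferSpectralRadius r.ρ β N ≤ μ k) ∧ (∀ k, μ k < transferSpectralRadius r.ρ β N) ∧
            (∀ (v : Lp ℝ 2 (Measure.pi fun _ : Edge 3 N => haarProbability G)) (l : ℝ),
              wilsonTorusTransferMatrix r.ρ β N v = l • v → (∀ k, ⟪e k, v⟫_ℝ = 0) →
                v = 0 ∨ l = transferSpectralRadius r.ρ β N ∨ l ≤ δ * qmin * transferSpectralRadius r.ρ β N) ∧
            -- the hopping kernel: on-site floor, diagonal dominance, two centred moments (relative to the scale `s`)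
            0 < s ∧
            (∀ u : EuclideanSpace ℂ (Fin n),
              s * ‖u‖ ^ 2 ≤ RCLike.re ⟪u, Matrix.toEuclideanLin ((transferKernel r β N ψ 0).map Complex.ofReal) u⟫_ℂ) ∧
            (∑ z ∈ Finset.univ.erase 0, entryNorm (transferKernel r β N ψ z) ≤ θ * s) ∧
            (entryNorm (transferKernel r β N ψ 0) ≤ M * s) ∧
            (∑ z, (siteSize z : ℝ) ^ 2 * entryNorm (transferKernel r β N ψ z) ≤ M * s) ∧
            -- volume stability of the band top
            (∃ kt, (∀ k, μ k ≤ μ kt) ∧ |Real.log (μ kt / transferSpectralRadius r.ρ β N) - ℓ| ≤ D' / (N : ℝ)) ∧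
            -- the dilute anchor
            (∃ s₀ : ℕ, (8 ≤ N → s₀ + 2 ≤ N / 4) ∧
              traceExcess r.ρ β N (s₀ + 2) ≤ 2 * ∑ k, (μ k / transferSpectralRadius r.ρ β N) ^ (s₀ + 2))

end Summit.QuantumFields.YangMills.Theorems.GlueballBandRecursion.Band

end
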